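import Mathlib
import Summits.Ventures.PercRepro2.K5K3Tables
import Summits.Ventures.PercRepro2.HCovTyped
import Summits.Ventures.PercRepro2.PMK5Deg4Kernel
import Summits.Ventures.PercRepro2.Deg3Tables
import Summits.Ventures.PercRepro2.Deg4Conn

/-!
# THE TWELVE FUNCTIONS OF `K₃` ON `K₅ + {a₃x, a₃y, a₃z, a₃w}` ARE THE TABLES OF `PMK5Deg4Kernel.lean`
(blind cell PercRepro2, mine-2 g28; mine-2 g27's `Deg3Tables.lean` (typer-1's `K5K3Tables.lean`) on the
fourteen-edge skeletons, parametrised by the attachment quadruple `(x, y, z, w)`)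

On `K₅ + {a₃x, a₃y, a₃z, a₃w}` with the marks `(o, a₁, a₂, a₃, b) = (0, 1, 2, 5, 4)` the twelve functions of p1's kernel
`K₃` (`HCovFns.lean`) are differences of the `0/1` tables: `1_{v∈C₁}`, `1_{v∈C₂}`, `1_Q`, `1_PD` are the tables
`tL v`, `tH v`, `tQ`, `tPD` (`iL_eq`, …, `iPD_eq3`, through `Deg4Conn.conn_iff`), and on `Q` no vertex lies in
both clusters (`conn12_of`), so each `f_i` is `f_i⁺ − f_i⁻` (`f3_eq`, …, `f12_eq`, by typer-1's Boolean identities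
`K5.f3_bool`, …, `K5.f12_bool`, which are about Booleans only).  Hence **`K3_apply`**: `K₃ a b c` is the signed
sum of the twenty products of tables of `kPos` / `kNeg`, in the order `a, b, c`; `indR`, `indR_mul`,
`coef3_eq_cnt3n` are the fourteen-edge copies of `K5Theorem`'s (`Deg3.cnt3n`: the triple counts on any number of edges).
-/

namespace Summit.Ventures.PercRepro2

open Hub

namespace Deg4

section Tables

variable {R : Type*} [Field R] (x y z w : Fin 5)

/-- The `0/1` indicator of a table, as a function into `R`. -/
def indR (T : (Fin 14 → Bool) → Bool) : (Fin 14 → Bool) → R := fun ω => if T ω then 1 else 0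

/-- The indicator of a set of configurations is `indR` of any table of the set. -/
lemma indicator_eq_indR (X : Set (Config (Fin 14))) (T : (Fin 14 → Bool) → Bool)
    (hT : ∀ ω, T ω = true ↔ ω ∈ X) : X.indicator (1 : Config (Fin 14) → R) = indR T := by
  funext ω
  unfold indR
  by_cases h : ω ∈ X
  · rw [Set.indicator_of_mem h, if_pos ((hT ω).2 h)]
    rfl
  · rw [Set.indicator_of_notMem h, if_neg (fun h' => h ((hT ω).1 h'))]

/-- A product of three `0/1` values is the cast of the product of the bits. -/
lemma indR_mul (T₁ T₂ T₃ : (Fin 14 → Bool) → Bool) (a b c : Fin 14 → Bool) :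
    (indR T₁ a : R) * indR T₂ b * indR T₃ c = (((T₁ a).toNat * (T₂ b).toNat * (T₃ c).toNat : ℕ) : R) := by
  unfold indR
  cases T₁ a <;> cases T₂ b <;> cases T₃ c <;> simp

/-- The Bernstein coefficient of three tables is the cast of the triple count. -/
lemma coef3_eq_cnt3n (T₁ T₂ T₃ : (Fin 14 → Bool) → Bool) (k : Fin 14 → Fin 4) :
    coef3 (indR T₁) (indR T₂) (indR T₃) k = ((Deg3.cnt3n T₁ T₂ T₃ k : ℕ) : R) := by
  unfold coef3 Deg3.cnt3n
  rw [Nat.cast_sum]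
  exact Finset.sum_congr rfl fun t _ => indR_mul T₁ T₂ T₃ t.1 t.2.1 t.2.2

/-- `1_{v∈C₁}` is the table `L_v`. -/
lemma iL_eq (v : Fin 6) : (CovForm.iL (ends14 x y z w) 1 v : Config (Fin 14) → R) = indR (tL x y z w v) :=
  indicator_eq_indR _ _ (tL_iff x y z w v)

/-- `1_{v∈C₂}` is the table `H_v`. -/
lemma iH_eq (v : Fin 6) : (CovForm.iH (ends14 x y z w) 2 v : Config (Fin 14) → R) = indR (tH x y z w v) :=
  indicator_eq_indR _ _ (tH_iff x y z w v)

/-- `1_Q` is the table `tQ`. -/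
lemma iQ_eq3 : (CovForm.iQ (ends14 x y z w) 1 2 : Config (Fin 14) → R) = indR (tQ x y z w) :=
  indicator_eq_indR _ _ (tQ_iff x y z w)

/-- `1_PD` is the table `tPD`. -/
lemma iPD_eq3 : (CovForm.iPD (ends14 x y z w) 1 2 5 : Config (Fin 14) → R) = indR (tPD x y z w) :=
  indicator_eq_indR _ _ (tPD_iff x y z w)

/-- `((5 : Fin 6) : ℕ) = 5`. -/
lemma val5 : ((5 : Fin 6) : ℕ) = 5 := rfl

/-- `((4 : Fin 6) : ℕ) = 4`. -/
lemma val4 : ((4 : Fin 6) : ℕ) = 4 := rfl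

/-- **On `Q` no vertex lies in both clusters**: `v ∈ C₁` and `v ∈ C₂` force `a₁ ↔ a₂`. -/
lemma conn12_of (ω : Fin 14 → Bool) (v : Fin 6) (hL : conn x y z w ω 1 v = true)
    (hH : conn x y z w ω 2 v = true) : conn x y z w ω 1 2 = true := by
  have h1 : Conn (ends14 x y z w) ω 1 v := (conn_iff x y z w ω 1 v).1 hL
  have h2 : Conn (ends14 x y z w) ω 2 v := (conn_iff x y z w ω 2 v).1 hH
  exact (conn_iff x y z w ω 1 2).2 (conn_trans h1 (conn_symm h2))

/-- `f₃ = 1_PD 1_{o∈U}` is the table `tPDoU`. -/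
lemma f3_eq : (CovForm.f3 (ends14 x y z w) 0 1 2 5 : Config (Fin 14) → R) = indR (tPDoU x y z w) := by
  funext ω
  unfold CovForm.f3 CovForm.inU
  rw [iPD_eq3 x y z w, iL_eq x y z w, iH_eq x y z w]
  unfold indR tPDoU tPD tQ tU tL tH
  exact K5.f3_bool _ _ _ _ _ (conn12_of x y z w ω 0)

/-- `f₄ = 1_Q σ_o σ_b` is `t4p − t4m`. -/
lemma f4_eq :
    (CovForm.f4 (ends14 x y z w) 0 1 2 4 : Config (Fin 14) → R) = fun ω => indR (t4p x y z w) ω - indR (t4m x y z w) ω := by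
  funext ω
  unfold CovForm.f4 CovForm.sigma
  rw [iQ_eq3 x y z w, iL_eq x y z w, iH_eq x y z w, iL_eq x y z w, iH_eq x y z w]
  unfold indR t4p t4m tSame tOpp tQ tL tH
  exact K5.f4_bool _ _ _ _ _ (conn12_of x y z w ω 0) (conn12_of x y z w ω 4)

/-- `f₅ = 1_Q σ₃ σ_b` is `t5p − t5m`. -/
lemma f5_eq :
    (CovForm.f5 (ends14 x y z w) 1 2 5 4 : Config (Fin 14) → R) = fun ω => indR (t5p x y z w) ω - indR (t5m x y z w) ω := by
  funext ω
  unfold CovForm.f5 CovForm.sigma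
  rw [iQ_eq3 x y z w, iL_eq x y z w, iH_eq x y z w, iL_eq x y z w, iH_eq x y z w]
  unfold indR t5p t5m tSame tOpp tQ tL tH
  exact K5.f4_bool _ _ _ _ _ (conn12_of x y z w ω 5) (conn12_of x y z w ω 4)

/-- `f₆ = 1_Q σ₃ 1_{o∈U} σ_b` is `t6p − t6m`. -/
lemma f6_eq :
    (CovForm.f6 (ends14 x y z w) 0 1 2 5 4 : Config (Fin 14) → R) = fun ω => indR (t6p x y z w) ω - indR (t6m x y z w) ω := by
  funext ω
  unfold CovForm.f6 CovForm.sigma CovForm.inU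
  rw [iQ_eq3 x y z w, iL_eq x y z w, iH_eq x y z w, iL_eq x y z w, iH_eq x y z w, iL_eq x y z w, iH_eq x y z w]
  unfold indR t6p t6m tSame tOpp tU tQ tL tH
  exact K5.f6_bool _ _ _ _ _ _ _ (conn12_of x y z w ω 5) (conn12_of x y z w ω 0) (conn12_of x y z w ω 4)

/-- `f₇ = 1_Q σ_v` is `t7p v − t7m v`. -/
lemma f7_eq (v : Fin 6) :
    (CovForm.f7 (ends14 x y z w) 1 2 v : Config (Fin 14) → R) = fun ω => indR (t7p x y z w v) ω - indR (t7m x y z w v) ω := by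
  funext ω
  unfold CovForm.f7 CovForm.sigma
  rw [iQ_eq3 x y z w, iL_eq x y z w, iH_eq x y z w]
  unfold indR t7p t7m tQ tL tH
  exact K5.f7_bool _ _ _ (conn12_of x y z w ω v)

/-- `f₁₀ = 1_Q σ₃ 1_{o∈U}` is `t10p − t10m`. -/
lemma f10_eq :
    (CovForm.f10 (ends14 x y z w) 0 1 2 5 : Config (Fin 14) → R) = fun ω => indR (t10p x y z w) ω - indR (t10m x y z w) ω := by
  funext ω
  unfold CovForm.f10 CovForm.sigma CovForm.inU
  rw [iQ_eq3 x y z w, iL_eq x y z w, iH_eq x y z w, iL_eq x y z w, iH_eq x y z w]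
  unfold indR t10p t10m tU tQ tL tH
  exact K5.f10_bool _ _ _ _ _ (conn12_of x y z w ω 5) (conn12_of x y z w ω 0)

/-- `f₁₁ = 1_PD 1_{o∈U} 1_{b∈U}` is the table `t11`. -/
lemma f11_eq : (CovForm.f11 (ends14 x y z w) 0 1 2 5 4 : Config (Fin 14) → R) = indR (t11 x y z w) := by
  funext ω
  unfold CovForm.f11 CovForm.inU
  rw [iPD_eq3 x y z w, iL_eq x y z w, iH_eq x y z w, iL_eq x y z w, iH_eq x y z w]
  unfold indR t11 tU tPD tQ tL tH
  exact K5.f11_bool _ _ _ _ _ _ _ (conn12_of x y z w ω 0) (conn12_of x y z w ω 4)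

/-- `f₁₂ = 1_PD 1_{b∈U}` is the table `t12`. -/
lemma f12_eq : (CovForm.f12 (ends14 x y z w) 1 2 5 4 : Config (Fin 14) → R) = indR (t12 x y z w) := by
  funext ω
  unfold CovForm.f12 CovForm.inU
  rw [iPD_eq3 x y z w, iL_eq x y z w, iH_eq x y z w]
  unfold indR t12 tU tPD tQ tL tH
  exact K5.f12_bool _ _ _ _ _ (conn12_of x y z w ω 4)

/-- **The kernel `K₃` on `K₅ + {a₃x, a₃y, a₃z, a₃w}` is the signed sum of twenty products of tables** (the ten positive
products of `kPos`, then the ten negative products of `kNeg`, in the order `x, y, w`). -/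
lemma K3_apply (a b c : Config (Fin 14)) :
    CovForm.K3 (R := R) (ends14 x y z w) 0 1 2 5 4 a b c =
      (indR (tPD x y z w) a * indR (tQ x y z w) b * indR (t4p x y z w) c + indR (tQ x y z w) a * indR (tPDoU x y z w) b * indR (t5p x y z w) c +
        indR (tPD x y z w) a * indR (tQ x y z w) b * indR (t6m x y z w) c +
        indR (tPD x y z w) a * indR (t7p x y z w 4) b * indR (t7m x y z w 0) c + indR (tPD x y z w) a * indR (t7m x y z w 4) b * indR (t7p x y z w 0) c +
        indR (tPDoU x y z w) a * indR (t7p x y z w 4) b * indR (t7m x y z w 5) c + indR (tPDoU x y z w) a * indR (t7m x y z w 4) b * indR (t7p x y z w 5) c +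
        indR (tPD x y z w) a * indR (t7p x y z w 4) b * indR (t10p x y z w) c + indR (tPD x y z w) a * indR (t7m x y z w 4) b * indR (t10m x y z w) c +
        indR (tQ x y z w) a * indR (t12 x y z w) b * indR (tPDoU x y z w) c) -
      (indR (tPD x y z w) a * indR (tQ x y z w) b * indR (t4m x y z w) c + indR (tQ x y z w) a * indR (tPDoU x y z w) b * indR (t5m x y z w) c +
        indR (tPD x y z w) a * indR (tQ x y z w) b * indR (t6p x y z w) c +
        indR (tPD x y z w) a * indR (t7p x y z w 4) b * indR (t7p x y z w 0) c + indR (tPD x y z w) a * indR (t7m x y z w 4) b * indR (t7m x y z w 0) c +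
        indR (tPDoU x y z w) a * indR (t7p x y z w 4) b * indR (t7p x y z w 5) c + indR (tPDoU x y z w) a * indR (t7m x y z w 4) b * indR (t7m x y z w 5) c +
        indR (tPD x y z w) a * indR (t7p x y z w 4) b * indR (t10m x y z w) c + indR (tPD x y z w) a * indR (t7m x y z w 4) b * indR (t10p x y z w) c +
        indR (tPD x y z w) a * indR (tQ x y z w) b * indR (t11 x y z w) c) := by
  unfold CovForm.K3 CovForm.sepKernel
  simp only [Fin.sum_univ_succ, Fin.sum_univ_zero, Matrix.cons_val_zero, Matrix.cons_val_succ,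
    add_zero]
  rw [iPD_eq3 x y z w, iQ_eq3 x y z w, f3_eq x y z w, f4_eq x y z w, f5_eq x y z w, f6_eq x y z w, f7_eq x y z w, f7_eq x y z w, f7_eq x y z w, f10_eq x y z w,
    f11_eq x y z w, f12_eq x y z w]
  simp only [val5, val4, Fin.val_zero]
  ring

end Tables

end Deg4

end Summit.Ventures.PercRepro2
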